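import Summits.BirchSwinnertonDyer.BirchSwinnertonDyer.Theorems.PrintCf2SplitBadTwoUnrNotStrictOfFrameClassThree
import Summits.BirchSwinnertonDyer.BirchSwinnertonDyer.Theorems.PrintCf2SplitBadTwoUnrLocalDefectFrame
import HarnessLib

/-!
# «`Q = S_{W*}(K*_∞) ⧸ 𝔖_{v̄}(K*_∞, W*)` is INFINITE» on the road-α frame, class (iii) — UNCONDITIONAL
# (helper for crux stmt-BirchSwinnertonDyer-20368 `PrintCf2.SplitBadTwoRankOneOfFacts`, stub S3d `stub_strictDefectAtVbar_two`;
# cell `bsd-print-cf2`, seat `bsd-line-cf2-p1-w7` g5 — the arithmetic bit «Q infinite ⟹ Q = 𝓗, e_δ = χ(𝓗)» of -w3 g11's dichotomy)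

Class (iii) of the frame (`C • W = cm7^{(d)}`, `d % 8 = 3 ∨ (2 ∣ d ∧ (d/2) % 8 = 7)`; `K = ℚ(√−7)`, `2 = v·v̄`; `W* = E[𝔮_r^∞]` pinned at
`v`; `κ'` the line unramified outside `v̄`, `γ'` a topological generator).  The two inputs of
`not_finite_unrSelmer_quot_restrictedSelmerZp_of_frame_classThree` (p695439) are now BOTH tree theorems:
(Q ≠ 0) = `restrictedSelmerZp_addSubgroupOf_unrSelmer_ne_top_of_frame_classThree` (this seat, p695439) and
(B) = -w4 g11's `UnrBaseLift.natCard_endCoinvariants_conjUnr_eq_one_of_frame_classThree_of_finite` (p695592, his `h𝓛` discharged by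
`hL_of_frame_classThree`).  Hence:
* **`not_finite_unrSelmer_quot_restrictedSelmerZp_of_frame_classThree_of_finite`** — granted only `Finite (𝔖_{v̄}(K, W*))` (hfinB):
  `¬ Finite (S_{W*}(K*_∞) ⧸ 𝔖_{v̄}(K*_∞, W*))`;
* **`not_finite_unrSelmer_quot_restrictedSelmerZp_of_frame_classThree'`** — on S3d's own binders (rank `1`, `Ш(E/ℚ)` finite, the
  generator datum), hfinB := cf2c-w2 `RelaxationLift.finite_restrictedSelmerBase_of_frame` (p688193): NO displayed hypothesis.
This is the `hQ` of -w3 g11's `StrictDefect.hasCharValuationAt_restricted_of_unr_of_injective_of_not_finite` /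
`valuation_eq_add_of_injective_of_not_finite_endEigenPrimaryTorsion` on class (iii).

HONEST FRAMING: assembly by name; closes nothing (`--supports`).  No named fact, no definition, no `sorry`.  No summit statement is
proved by this file; BSD is not proved by any of this.

References: Greenberg–Vatsal 2000 §2 Prop. 2.1, Cor. 2.3; Greenberg LNM 1716 §4; Agboola 2007 §3 Prop. 3.2, §5.
-/

-- the summit namespace `Summit.BirchSwinnertonDyer.BirchSwinnertonDyer` repeats the problem name by design (D-0017)
set_option linter.dupNamespace false
set_option autoImplicit false

noncomputable section

open scoped Classical
open NumberField IsDedekindDomain Field WeierstrassCurve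
open Literature.NumberTheory.EllipticCurves Literature.NumberTheory.EllipticCurves.GreenbergSelmer
open Literature.NumberTheory.EllipticCurves.GreenbergVatsal2000 Literature.NumberTheory.EllipticCurves.KellerYin2024
open Literature.NumberTheory.EllipticCurves.Agboola2007 Literature.NumberTheory.EllipticCurves.IwasawaDual
open Literature.NumberTheory.GaloisRepresentations
open Summit.BirchSwinnertonDyer.BirchSwinnertonDyer.Theorems.PrintCf2
open Summit.BirchSwinnertonDyer.BirchSwinnertonDyer.Theorems.GoldfeldGoodTwists

namespace Summit.BirchSwinnertonDyer.BirchSwinnertonDyer.Theorems.PrintCf2.StrictDefectInfinite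

variable {K : Type} [Field K] [NumberField K]

/-- **`Q = S_{W*}(K*_∞) ⧸ 𝔖_{v̄}(K*_∞, W*)` is infinite on the class-(iii) frame, granted `𝔖_{v̄}(K, W*)` finite** — (Q ≠ 0) (p695439) and
(B) `#(S_{W*}(K*_∞))_Γ = 1` (-w4 g11 p695592) fed into the locally-nilpotent-surjection argument (p693491).
[cite: GreenbergVatsal2000, §2 Prop. 2.1, Cor. 2.3] [cite: GreenbergLNM1716, §4 p. 124] [cite: Agboola2007, §3 Prop. 3.2] -/
theorem not_finite_unrSelmer_quot_restrictedSelmerZp_of_frame_classThree_of_finite {d : ℤ} (hd0 : d ≠ 0) (hsq : Squarefree d)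
    (hd4 : d % 4 ≠ 1) (hcl : d % 8 = 3 ∨ ((2 : ℤ) ∣ d ∧ (d / 2) % 8 = 7)) (W : WeierstrassCurve ℚ) [W.IsElliptic] [W.IsGloballyMinimal]
    (C : VariableChange ℚ) (hC : C • W = cm7.quadraticTwist (d : ℚ)) (hK : IsImaginaryQuadratic K) (v vbar : HeightOneSpectrum (𝓞 K))
    (hv : ((2 : ℕ) : 𝓞 K) ∈ v.asIdeal) (hvbar : ((2 : ℕ) : 𝓞 K) ∈ vbar.asIdeal) (hne : vbar ≠ v)
    (π : (W.baseChange K).endRing) (hrel : (π : AddMonoid.End (W.baseChange K).geomPoints) * π = π - 2)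
    (r : ℤ_[2]) (hr : r * r = r - 2)
    (hpin : ∀ τ ∈ inertia v, ∀ x : ↥((W.baseChange K).endEigenPrimaryTorsion 2 π r), τ • x = x ∨ τ • x = -x)
    (κ' : ZpExtension K 2) (hκ' : κ'.IsUnramifiedOutside vbar) {γ' : absoluteGaloisGroup K} (hγ' : κ'.IsTopGenerator γ')
    (hfinB : Finite (restrictedSelmerBase ↥((W.baseChange K).endEigenPrimaryTorsion 2 π r) 2 vbar)) :
    ¬ Finite (unrSelmer κ' ↥((W.baseChange K).endEigenPrimaryTorsion 2 π r) vbar ∅ ⧸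
      (restrictedSelmerZp κ' ↥((W.baseChange K).endEigenPrimaryTorsion 2 π r) vbar).addSubgroupOf
        (unrSelmer κ' ↥((W.baseChange K).endEigenPrimaryTorsion 2 π r) vbar ∅)) :=
  not_finite_unrSelmer_quot_restrictedSelmerZp_of_frame_classThree hd0 hsq hd4 hcl W C hC hK v vbar hv hvbar hne π hrel r hr hpin
    κ' hκ' hγ' hfinB
    (UnrBaseLift.natCard_endCoinvariants_conjUnr_eq_one_of_frame_classThree_of_finite hd0 hcl W C hC hK hv hvbar hne π hrel hr hpin
      κ' hκ' hγ' hfinB)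

/-- **`Q` is infinite on S3d's own class-(iii) frame, NO displayed hypothesis** (hfinB := cf2c-w2's
`RelaxationLift.finite_restrictedSelmerBase_of_frame` from rank `1`, `Ш(E/ℚ)` finite and the generator datum).
[cite: GreenbergVatsal2000, §2 Cor. 2.3] [cite: Agboola2007, §3 Prop. 3.2, §5 Prop. 5.1] -/
theorem not_finite_unrSelmer_quot_restrictedSelmerZp_of_frame_classThree' {d : ℤ} (hd0 : d ≠ 0) (hsq : Squarefree d)
    (hd4 : d % 4 ≠ 1) (hcl : d % 8 = 3 ∨ ((2 : ℤ) ∣ d ∧ (d / 2) % 8 = 7)) (W : WeierstrassCurve ℚ) [W.IsElliptic] [W.IsGloballyMinimal]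
    (C : VariableChange ℚ) (hC : C • W = cm7.quadraticTwist (d : ℚ)) (hrank : W.analyticRank = 1) (hsha : Finite W.sha)
    (hK : IsImaginaryQuadratic K) (v vbar : HeightOneSpectrum (𝓞 K))
    (hv : ((2 : ℕ) : 𝓞 K) ∈ v.asIdeal) (hvbar : ((2 : ℕ) : 𝓞 K) ∈ vbar.asIdeal) (hne : vbar ≠ v)
    (π : (W.baseChange K).endRing) (hrel : (π : AddMonoid.End (W.baseChange K).geomPoints) * π = π - 2)
    (r : ℤ_[2]) (hr : r * r = r - 2)
    (hpin : ∀ τ ∈ inertia v, ∀ x : ↥((W.baseChange K).endEigenPrimaryTorsion 2 π r), τ • x = x ∨ τ • x = -x)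
    (κ' : ZpExtension K 2) (hκ' : κ'.IsUnramifiedOutside vbar) {γ' : absoluteGaloisGroup K} (hγ' : κ'.IsTopGenerator γ')
    (P : W.toAffine.Point) (c₀ : ℕ) (ℓ : ℤ) (hP : ¬ IsOfFinAddOrder P)
    (hgen : ∀ R : W.toAffine.Point, ∃ (k : ℤ) (T : W.toAffine.Point), IsOfFinAddOrder T ∧ R = k • P + T)
    (hc₀ : c₀ ≠ 0) (hker : (W.baseChange ℚ_[2]).IsInReductionKernel (c₀ • W.toPadicPoint 2 P))
    (hlog : ‖(W.baseChange ℚ_[2]).padicLogPoint (c₀ • W.toPadicPoint 2 P) / (c₀ : ℚ_[2])‖ = (2 : ℝ) ^ (-ℓ)) :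
    ¬ Finite (unrSelmer κ' ↥((W.baseChange K).endEigenPrimaryTorsion 2 π r) vbar ∅ ⧸
      (restrictedSelmerZp κ' ↥((W.baseChange K).endEigenPrimaryTorsion 2 π r) vbar).addSubgroupOf
        (unrSelmer κ' ↥((W.baseChange K).endEigenPrimaryTorsion 2 π r) vbar ∅)) :=
  not_finite_unrSelmer_quot_restrictedSelmerZp_of_frame_classThree_of_finite hd0 hsq hd4 hcl W C hC hK v vbar hv hvbar hne π hrel r
    hr hpin κ' hκ' hγ'
    (RelaxationLift.finite_restrictedSelmerBase_of_frame d hd0 hsq hd4 W C hC hrank hsha K hK v vbar hv hvbar hne π hrel r hr hpin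
      P c₀ ℓ hP hgen hc₀ hker hlog)

end Summit.BirchSwinnertonDyer.BirchSwinnertonDyer.Theorems.PrintCf2.StrictDefectInfinite

end
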